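import Mathlib

/-!
# Discrete Poincaré inequality on a cubic grid (pigeonhole form)

Generic combinatorial lemma (no geometry): for a function `U` on the grid `{0,…,n-1}³` whose nearest-neighbour increments are
bounded by a profile `Θ ≥ 0`, some grid point `y₀` has `Σ_x ‖U x − U y₀‖² ≤ 36·n²·Σ_x Θ x²`.  Proof: three-leg coordinate paths,
`(Σ D)² ≤ n Σ D²`, and the pigeonhole principle over the end point (the average over `y` of `Σ_x ‖U x − U y‖²` is `≤ 36 n² Σ Θ²`).
-/

open Finset
open scoped BigOperators

namespace Summit.AtomisticToContinuum.Crystallization.Theorems.ChartedZeroExcessLayeredLatticeLiouvilleWindowPoincare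

variable {V : Type*} [NormedAddCommGroup V]

/-- 1D chain bound: increments bounded by `D ≥ 0` ⇒ `‖f j − f 0‖ ≤ Σ_{k<n} D k` for `j < n`. [folklore] -/
theorem chain_bound (f : ℕ → V) (D : ℕ → ℝ) (n : ℕ) (hD : ∀ k, 0 ≤ D k)
    (hstep : ∀ k, k + 1 < n → ‖f (k + 1) - f k‖ ≤ D k) :
    ∀ j, j < n → ‖f j - f 0‖ ≤ ∑ k ∈ range n, D k := by
  intro j hj
  have key : ∀ t, t < n → ‖f t - f 0‖ ≤ ∑ k ∈ range t, D k := by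
    intro t
    induction t with
    | zero => intro _; simp
    | succ t ih =>
      intro ht
      calc ‖f (t + 1) - f 0‖ = ‖(f (t + 1) - f t) + (f t - f 0)‖ := by congr 1; abel
        _ ≤ ‖f (t + 1) - f t‖ + ‖f t - f 0‖ := norm_add_le _ _
        _ ≤ D t + ∑ k ∈ range t, D k := add_le_add (hstep t ht) (ih (by omega))
        _ = ∑ k ∈ range (t + 1), D k := by rw [sum_range_succ, add_comm]
  exact (key j hj).trans (sum_le_sum_of_subset_of_nonneg (range_mono hj.le) fun k _ _ => hD k)

/-- 1D two-point bound: `‖f i − f j‖ ≤ 2 Σ_{k<n} D k`. [folklore] -/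
theorem chain_bound_two (f : ℕ → V) (D : ℕ → ℝ) (n : ℕ) (hD : ∀ k, 0 ≤ D k)
    (hstep : ∀ k, k + 1 < n → ‖f (k + 1) - f k‖ ≤ D k) {i j : ℕ} (hi : i < n) (hj : j < n) :
    ‖f i - f j‖ ≤ 2 * ∑ k ∈ range n, D k := by
  calc ‖f i - f j‖ = ‖(f i - f 0) - (f j - f 0)‖ := by congr 1; abel
    _ ≤ ‖f i - f 0‖ + ‖f j - f 0‖ := norm_sub_le _ _
    _ ≤ ∑ k ∈ range n, D k + ∑ k ∈ range n, D k :=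
        add_le_add (chain_bound f D n hD hstep i hi) (chain_bound f D n hD hstep j hj)
    _ = 2 * ∑ k ∈ range n, D k := by ring

/-- squared form: `‖f i − f j‖² ≤ 4 n Σ_{k<n} D k²`. [folklore] -/
theorem chain_bound_sq (f : ℕ → V) (D : ℕ → ℝ) (n : ℕ) (hD : ∀ k, 0 ≤ D k)
    (hstep : ∀ k, k + 1 < n → ‖f (k + 1) - f k‖ ≤ D k) {i j : ℕ} (hi : i < n) (hj : j < n) :
    ‖f i - f j‖ ^ 2 ≤ 4 * n * ∑ k ∈ range n, D k ^ 2 := by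
  have h := chain_bound_two f D n hD hstep hi hj
  have hcs : (∑ k ∈ range n, D k) ^ 2 ≤ (range n).card * ∑ k ∈ range n, D k ^ 2 := sq_sum_le_card_mul_sum_sq
  rw [card_range] at hcs
  have h0 : 0 ≤ ∑ k ∈ range n, D k := sum_nonneg fun k _ => hD k
  calc ‖f i - f j‖ ^ 2 ≤ (2 * ∑ k ∈ range n, D k) ^ 2 := by
        exact pow_le_pow_left₀ (norm_nonneg _) h 2
    _ = 4 * (∑ k ∈ range n, D k) ^ 2 := by ring
    _ ≤ 4 * (n * ∑ k ∈ range n, D k ^ 2) := by gcongr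
    _ = 4 * n * ∑ k ∈ range n, D k ^ 2 := by ring

/-- `(p + q + r)² ≤ 3 (p² + q² + r²)` (private copy; the tree has it in a number-theory module not worth importing). -/
private theorem add_three_sq_le (p q r : ℝ) : (p + q + r) ^ 2 ≤ 3 * (p ^ 2 + q ^ 2 + r ^ 2) := by
  nlinarith [sq_nonneg (p - q), sq_nonneg (q - r), sq_nonneg (p - r)]

/-- six-fold sum of a term depending on the 5th and 6th variables. [folklore] -/
theorem sum6_dep56 (n : ℕ) (F : ℕ → ℕ → ℝ) :
    ∑ _a' ∈ range n, ∑ _b' ∈ range n, ∑ _c' ∈ range n, ∑ _a ∈ range n, ∑ b ∈ range n, ∑ c ∈ range n, F b c =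
      (n : ℝ) ^ 4 * ∑ b ∈ range n, ∑ c ∈ range n, F b c := by
  simp only [sum_const, card_range, nsmul_eq_mul]
  ring

/-- six-fold sum of a term depending on the 1st and 6th variables. [folklore] -/
theorem sum6_dep16 (n : ℕ) (F : ℕ → ℕ → ℝ) :
    ∑ a' ∈ range n, ∑ _b' ∈ range n, ∑ _c' ∈ range n, ∑ _a ∈ range n, ∑ _b ∈ range n, ∑ c ∈ range n, F a' c =
      (n : ℝ) ^ 4 * ∑ a' ∈ range n, ∑ c ∈ range n, F a' c := by
  simp only [sum_const, card_range, nsmul_eq_mul]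
  rw [mul_sum]
  refine sum_congr rfl fun a' _ => ?_
  ring

/-- six-fold sum of a term depending on the 1st and 2nd variables. [folklore] -/
theorem sum6_dep12 (n : ℕ) (F : ℕ → ℕ → ℝ) :
    ∑ a' ∈ range n, ∑ b' ∈ range n, ∑ _c' ∈ range n, ∑ _a ∈ range n, ∑ _b ∈ range n, ∑ _c ∈ range n, F a' b' =
      (n : ℝ) ^ 4 * ∑ a' ∈ range n, ∑ b' ∈ range n, F a' b' := by
  simp only [sum_const, card_range, nsmul_eq_mul]
  rw [mul_sum]
  refine sum_congr rfl fun a' _ => ?_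
  rw [mul_sum]
  refine sum_congr rfl fun b' _ => ?_
  ring

/-- ★ **Discrete Poincaré inequality on the grid `{0,…,n-1}³`, pigeonhole form.**  If the nearest-neighbour increments of `U` are
bounded by `Θ ≥ 0` (each increment by `Θ` at its lower end point), then some grid point `y₀ = (a', b', c')` has
`Σ_x ‖U x − U y₀‖² ≤ 36 n² Σ_x Θ x²`.  [folklore: three-leg coordinate paths + Cauchy–Schwarz + pigeonhole] -/
theorem grid_poincare (n : ℕ) (hn : 0 < n) (U : ℕ → ℕ → ℕ → V) (Θ : ℕ → ℕ → ℕ → ℝ) (hΘ : ∀ i j k, 0 ≤ Θ i j k)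
    (h1 : ∀ i j k, i + 1 < n → j < n → k < n → ‖U (i + 1) j k - U i j k‖ ≤ Θ i j k)
    (h2 : ∀ i j k, i < n → j + 1 < n → k < n → ‖U i (j + 1) k - U i j k‖ ≤ Θ i j k)
    (h3 : ∀ i j k, i < n → j < n → k + 1 < n → ‖U i j (k + 1) - U i j k‖ ≤ Θ i j k) :
    ∃ a' ∈ range n, ∃ b' ∈ range n, ∃ c' ∈ range n,
      ∑ a ∈ range n, ∑ b ∈ range n, ∑ c ∈ range n, ‖U a b c - U a' b' c'‖ ^ 2 ≤
        36 * (n : ℝ) ^ 2 * ∑ a ∈ range n, ∑ b ∈ range n, ∑ c ∈ range n, Θ a b c ^ 2 := by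
  obtain ⟨S, hS⟩ : ∃ S : ℝ, S = ∑ a ∈ range n, ∑ b ∈ range n, ∑ c ∈ range n, Θ a b c ^ 2 := ⟨_, rfl⟩
  obtain ⟨P, hP⟩ : ∃ P : ℕ → ℕ → ℝ, P = fun b c => ∑ i ∈ range n, Θ i b c ^ 2 := ⟨_, rfl⟩
  obtain ⟨Q, hQ⟩ : ∃ Q : ℕ → ℕ → ℝ, Q = fun a c => ∑ j ∈ range n, Θ a j c ^ 2 := ⟨_, rfl⟩
  obtain ⟨Rr, hRr⟩ : ∃ Rr : ℕ → ℕ → ℝ, Rr = fun a b => ∑ k ∈ range n, Θ a b k ^ 2 := ⟨_, rfl⟩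
  rw [← hS]
  -- pointwise three-leg bound
  have hpt : ∀ a' ∈ range n, ∀ b' ∈ range n, ∀ c' ∈ range n, ∀ a ∈ range n, ∀ b ∈ range n, ∀ c ∈ range n,
      ‖U a b c - U a' b' c'‖ ^ 2 ≤ 12 * n * P b c + 12 * n * Q a' c + 12 * n * Rr a' b' := by
    intro a' ha' b' hb' c' hc' a ha b hb c hc
    rw [mem_range] at ha hb hc ha' hb' hc'
    have l1 : ‖U a b c - U a' b c‖ ^ 2 ≤ 4 * n * P b c := by
      rw [hP]
      exact chain_bound_sq (fun i => U i b c) (fun i => Θ i b c) n (fun i => hΘ i b c)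
        (fun i hi => h1 i b c hi hb hc) ha ha'
    have l2 : ‖U a' b c - U a' b' c‖ ^ 2 ≤ 4 * n * Q a' c := by
      rw [hQ]
      exact chain_bound_sq (fun j => U a' j c) (fun j => Θ a' j c) n (fun j => hΘ a' j c)
        (fun j hj => h2 a' j c ha' hj hc) hb hb'
    have l3 : ‖U a' b' c - U a' b' c'‖ ^ 2 ≤ 4 * n * Rr a' b' := by
      rw [hRr]
      exact chain_bound_sq (fun k => U a' b' k) (fun k => Θ a' b' k) n (fun k => hΘ a' b' k)
        (fun k hk => h3 a' b' k ha' hb' hk) hc hc'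
    have htri : ‖U a b c - U a' b' c'‖ ≤
        ‖U a b c - U a' b c‖ + ‖U a' b c - U a' b' c‖ + ‖U a' b' c - U a' b' c'‖ := by
      calc ‖U a b c - U a' b' c'‖
          = ‖(U a b c - U a' b c) + (U a' b c - U a' b' c) + (U a' b' c - U a' b' c')‖ := by congr 1; abel
        _ ≤ ‖(U a b c - U a' b c) + (U a' b c - U a' b' c)‖ + ‖U a' b' c - U a' b' c'‖ := norm_add_le _ _
        _ ≤ _ := by gcongr; exact norm_add_le _ _
    calc ‖U a b c - U a' b' c'‖ ^ 2
        ≤ (‖U a b c - U a' b c‖ + ‖U a' b c - U a' b' c‖ + ‖U a' b' c - U a' b' c'‖) ^ 2 :=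
          pow_le_pow_left₀ (norm_nonneg _) htri 2
      _ ≤ 3 * (‖U a b c - U a' b c‖ ^ 2 + ‖U a' b c - U a' b' c‖ ^ 2 + ‖U a' b' c - U a' b' c'‖ ^ 2) :=
          add_three_sq_le _ _ _
      _ ≤ 3 * (4 * n * P b c + 4 * n * Q a' c + 4 * n * Rr a' b') := by gcongr
      _ = 12 * n * P b c + 12 * n * Q a' c + 12 * n * Rr a' b' := by ring
  -- budget sums
  have hPS : ∑ b ∈ range n, ∑ c ∈ range n, P b c = S := by
    rw [hP, hS]
    refine (sum_congr rfl fun b _ => sum_comm).trans ?_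
    exact sum_comm
  have hQS : ∑ a' ∈ range n, ∑ c ∈ range n, Q a' c = S := by
    rw [hQ, hS]
    exact sum_congr rfl fun a _ => sum_comm
  have hRS : ∑ a' ∈ range n, ∑ b' ∈ range n, Rr a' b' = S := by
    rw [hRr, hS]
  -- the double sum
  have hdouble : ∑ a' ∈ range n, ∑ b' ∈ range n, ∑ c' ∈ range n,
      (∑ a ∈ range n, ∑ b ∈ range n, ∑ c ∈ range n, ‖U a b c - U a' b' c'‖ ^ 2) ≤
      ∑ a' ∈ range n, ∑ b' ∈ range n, ∑ c' ∈ range n, (36 * (n : ℝ) ^ 2 * S) := by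
    have hsw : ∑ a' ∈ range n, ∑ b' ∈ range n, ∑ c' ∈ range n,
        (∑ a ∈ range n, ∑ b ∈ range n, ∑ c ∈ range n, ‖U a b c - U a' b' c'‖ ^ 2) ≤
        ∑ a' ∈ range n, ∑ b' ∈ range n, ∑ c' ∈ range n, ∑ a ∈ range n, ∑ b ∈ range n, ∑ c ∈ range n,
          (12 * n * P b c + 12 * n * Q a' c + 12 * n * Rr a' b') := by
      refine sum_le_sum fun a' ha' => sum_le_sum fun b' hb' => sum_le_sum fun c' hc' =>
        sum_le_sum fun a ha => sum_le_sum fun b hb => sum_le_sum fun c hc => ?_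
      exact hpt a' ha' b' hb' c' hc' a ha b hb c hc
    refine hsw.trans (le_of_eq ?_)
    simp only [sum_add_distrib]
    have e1 : (∑ a' ∈ range n, ∑ b' ∈ range n, ∑ c' ∈ range n, ∑ a ∈ range n, ∑ b ∈ range n, ∑ c ∈ range n,
        12 * (n : ℝ) * P b c) = (n : ℝ) ^ 4 * ∑ b ∈ range n, ∑ c ∈ range n, 12 * (n : ℝ) * P b c :=
      sum6_dep56 n _
    have e2 : (∑ a' ∈ range n, ∑ b' ∈ range n, ∑ c' ∈ range n, ∑ a ∈ range n, ∑ b ∈ range n, ∑ c ∈ range n,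
        12 * (n : ℝ) * Q a' c) = (n : ℝ) ^ 4 * ∑ a' ∈ range n, ∑ c ∈ range n, 12 * (n : ℝ) * Q a' c :=
      sum6_dep16 n _
    have e3 : (∑ a' ∈ range n, ∑ b' ∈ range n, ∑ c' ∈ range n, ∑ a ∈ range n, ∑ b ∈ range n, ∑ c ∈ range n,
        12 * (n : ℝ) * Rr a' b') = (n : ℝ) ^ 4 * ∑ a' ∈ range n, ∑ b' ∈ range n, 12 * (n : ℝ) * Rr a' b' :=
      sum6_dep12 n _
    rw [e1, e2, e3]
    simp only [← mul_sum]
    rw [hPS, hQS, hRS]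
    simp only [sum_const, card_range, nsmul_eq_mul]
    ring
  -- pigeonhole over (a', b', c')
  have hne : (range n).Nonempty := nonempty_range_iff.2 hn.ne'
  obtain ⟨a', ha', h1'⟩ := exists_le_of_sum_le hne hdouble
  obtain ⟨b', hb', h2'⟩ := exists_le_of_sum_le hne h1'
  obtain ⟨c', hc', h3'⟩ := exists_le_of_sum_le hne h2'
  exact ⟨a', ha', b', hb', c', hc', h3'⟩

end Summit.AtomisticToContinuum.Crystallization.Theorems.ChartedZeroExcessLayeredLatticeLiouvilleWindowPoincare
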